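import Summits.Ventures.Crystal3D.Theorems.StickyWulffConstantGenericWallFloorStackLedgerLocalCount
import Summits.Ventures.Crystal3D.Theorems.StickyWulffConstantGenericWallFloorWalkReach
import HarnessLib

/-!
# CAP-START: launching and stepping stack walkers on twin-dozen (Barlow / hcp-layer) material
# (crux `GenericWallFloor`, stmt-Ventures-19480, line `WallLedgerG`; lane-T interface under decision (xxxiv‴))

HONEST FRAMING. Part of the venture `Summits/Ventures/Crystal3D` (cell `crystal3d-full`), helper `--supports` the
crux `GenericWallFloor` (stmt-Ventures-19480) of `route-Ventures-StickyWulffConstant`, registered line `WallLedgerG`,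
open stub `stub_twoSlabAdhesion`.  Rung credit only; F-C1 not moved; NOT the stub.

The stack ledger (`…StackLedger*`) launches one walker per steep lattice line from a ball with its FULL `A`-dozen
(`walkInv_start`): a Barlow/hcp plate has no such ball in an `h`-layer.  This file supplies the start-side and
step-side tools for walkers on TWIN-DOZEN material (a ball whose nine `n`-non-negative `F`-slots are occupied —
the in-plane hexagon and the upper triangle of a layer ball, `F` the bilayer frame, `n` the basal normal):

* `walkInv_capStart` — the one-level state `(p + F v, [⟨F, v, 0⟩])` over a HALF-FULL `p` (nine `n`-non-negative
  `F`-slots occupied, `⟪F v, n⟫ > 0`, `v` steep) satisfies `WalkInv`; `walkCertified12_of_full` /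
  `walkCertified12_of_twinDozen` — the strong certificate from the predecessor's full dozen or full TWIN dozen
  (the three lowered positive slots `p + F w − 2√(2/3) n` occupied: the layer below); `capWalk_end` — the packaged
  pay-off (`stackWalk_end`) from a half-full start.
* `pushEntry_sound`, `walkInv_capStart₂` — the two-level canonical state `(p + G q, [⟨G, q, n⟩, ⟨F, v, 0⟩])`
  (`G` the twin of `F` across `n`, `q = bestCapper G n z`) over a `G`-half-full `p` is valid (`WalkInv ∧ StackWF`)
  whenever `F v` is steep and `n`-positive: the state a walker carries on a bilayer of the twin class.
* `isOrientedCap_of_twinDozen`, `orientedCap_normal_unique`, `walkStep_push_of_orientedCap_nil`,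
  `walkStep_pop_of_orientedCap`, `walkStep_push_of_orientedCap_ne` — the deterministic zigzag: at a ball whose
  `F`-lower half and twin cappers are occupied the upper `F`-triangle is EMPTY (hexagram, `1`-separation), the cap
  normal is unique, and the step is the PUSH into the twin frame / the POP back to the frame below.
* `walkRun_height_ge`, `walkRun_ne_of_exit`, **`walkRun_injOn_of_orbitFree`**, **`walkRun_injOn_of_exit`** — the
  map `start ↦ state after N steps` is injective on any finite family of valid, pairwise distinct start states none
  of which lies on another's forward orbit; and a family whose members sit at height `≤ H₀` while every member's
  FIRST step lands above `H₀` is orbit-free.  This replaces the fcc-only deep-prefix / interval argument of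
  `walkRun_start_injective` (which used the fullness of the whole clamped sample) by a criterion that reads nothing
  below the start ball.

What the walk reads (answer of record to wulff-p2 g12, 2026-08-28): the STEP reads only the current ball's dozen and
cappers; the START certificate reads the predecessor's dozen / twin dozen (top THREE layers of a plate); injectivity
reads nothing deeper (height criterion); reach-set membership is `walkRun_fst_mem_reachSet` (any start state).
Sealing, the inner-sample flux count and the inner-face deficit are plate-specific and are NOT here.

WHAT THIS IS NOT: not the stub; not a Barlow-plate ledger (the flux count of zigzag lines and Barlow sealing are
separate); `ExactOnly` (C12-55) remains an input BY NAME wherever the walk's pay-off is used; F-C1 not moved.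
-/

noncomputable section

namespace Summit.Ventures.Crystal3D.Theorems

open Finset
open scoped InnerProductSpace

variable {X : Finset (EuclideanSpace ℝ (Fin 3))}

/-! ### One-level cap starts: half-full predecessor -/

/-- **The cap-start state satisfies the invariant.**  `p ∈ X` with the nine `n`-non-negative `F`-slots occupied
(`n` a unit menu normal of `F`), a slot `v` with `⟪F v, n⟫ > 0` that is steep for `z` (`⟪F v, z⟫ ≥ √2/2`): the
one-level state `(p + F v, [⟨F, v, 0⟩])` satisfies `WalkInv` (certified by the cap branch). -/
theorem walkInv_capStart (F : EuclideanSpace ℝ (Fin 3) ≃ₗᵢ[ℝ] EuclideanSpace ℝ (Fin 3))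
    {z p v n : EuclideanSpace ℝ (Fin 3)} (hp : p ∈ X) (hn : ‖n‖ = 1)
    (hmenu : ∀ w ∈ fccSlots, ⟪F w, n⟫_ℝ = 0 ∨ ⟪F w, n⟫_ℝ = Real.sqrt (2 / 3) ∨ ⟪F w, n⟫_ℝ = -Real.sqrt (2 / 3))
    (hvn : 0 < ⟪F v, n⟫_ℝ) (hhalf : ∀ w ∈ fccSlots, 0 ≤ ⟪F w, n⟫_ℝ → p + F w ∈ X)
    (hv : v ∈ fccSlots) (hsteep : Real.sqrt 2 / 2 ≤ ⟪F v, z⟫_ℝ) :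
    WalkInv X z (p + F v, [⟨F, v, 0⟩]) := by
  refine ⟨hhalf v hv hvn.le, ⟨hv, hsteep⟩, ⟨F, v, 0⟩, [], rfl, Or.inr ⟨n, hn, hmenu, hvn, ?_, fun w hw h0 => ?_⟩⟩
  · simp [hp]
  · simp only [add_sub_cancel_right]; exact hhalf w hw h0

/-- **Strong certificate from a FULL predecessor** (any entry normal `m`). -/
theorem walkCertified12_of_full (G : EuclideanSpace ℝ (Fin 3) ≃ₗᵢ[ℝ] EuclideanSpace ℝ (Fin 3))
    {p q m : EuclideanSpace ℝ (Fin 3)} (hp : p ∈ X) (hfull : ∀ w ∈ fccSlots, p + G w ∈ X) :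
    WalkCertified12 X (p + G q) ⟨G, q, m⟩ :=
  Or.inl ⟨by simp [hp], fun w hw => by simp only [add_sub_cancel_right]; exact hfull w hw⟩

/-- **Strong certificate from a full TWIN DOZEN.**  The predecessor `p ∈ X` carries the nine `n`-non-negative
`G`-slots AND the three lowered positive slots `p + G w − 2√(2/3) n` (`⟪G w, n⟫ > 0`): the twelve balls of an
`h`-layer ball (hexagon, upper triangle, twin lower triangle); `⟪G q, n⟫ > 0`.  Then the walker at `p + G q` with
entry `⟨G, q, m⟩` (any `m`) carries `WalkCertified12` (cap branch with normal `n`). -/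
theorem walkCertified12_of_twinDozen (G : EuclideanSpace ℝ (Fin 3) ≃ₗᵢ[ℝ] EuclideanSpace ℝ (Fin 3))
    {p q m n : EuclideanSpace ℝ (Fin 3)} (hn : ‖n‖ = 1)
    (hmenu : ∀ w ∈ fccSlots, ⟪G w, n⟫_ℝ = 0 ∨ ⟪G w, n⟫_ℝ = Real.sqrt (2 / 3) ∨ ⟪G w, n⟫_ℝ = -Real.sqrt (2 / 3))
    (hqn : 0 < ⟪G q, n⟫_ℝ) (hp : p ∈ X) (hhalf : ∀ w ∈ fccSlots, 0 ≤ ⟪G w, n⟫_ℝ → p + G w ∈ X)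
    (hlow : ∀ w ∈ fccSlots, 0 < ⟪G w, n⟫_ℝ → p + G w - (2 * Real.sqrt (2 / 3)) • n ∈ X) :
    WalkCertified12 X (p + G q) ⟨G, q, m⟩ :=
  Or.inr ⟨n, hn, hmenu, hqn, by simp [hp], fun w hw h0 => by simp only [add_sub_cancel_right]; exact hhalf w hw h0,
    fun w hw h0 => by simp only [add_sub_cancel_right]; exact hlow w hw h0⟩

/-- **The cap-started walker, end to end** (`stackWalk_end` packaged; cf. `grainWalk_end`).  `X` `1`-separated with
heights `⟪q, z⟫ ≤ H`, the C12-55 row, a half-full `p ∈ X` for `(F, n)`, an `n`-positive steep slot `v`; with fuel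
`N`, `8(H − ⟪p + F v, z⟫) < 3N`, the end ball `y = walkEnd X z N (p + F v) [⟨F, v, 0⟩]` is in `X`, has `≤ 11`
contacts, `⟪y − (p + F v), z⟫ ≥ 0` and `‖y − (p + F v)‖ ≤ (8/3)(H − ⟪p + F v, z⟫)`. -/
theorem capWalk_end (hX : ∀ p ∈ X, ∀ q ∈ X, p ≠ q → 1 ≤ dist p q)
    {s₀ : EuclideanSpace ℝ (Fin 3)} (hs₀ : s₀ ∈ fccSlots)
    (hcert : ExactOnly 0 (fccSlots.filter fun w => 0 < ⟪w, s₀⟫_ℝ))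
    {z : EuclideanSpace ℝ (Fin 3)} (hz : ‖z‖ = 1) {H : ℝ} (hH : ∀ q ∈ X, ⟪q, z⟫_ℝ ≤ H)
    (F : EuclideanSpace ℝ (Fin 3) ≃ₗᵢ[ℝ] EuclideanSpace ℝ (Fin 3))
    {p v n : EuclideanSpace ℝ (Fin 3)} (hp : p ∈ X) (hn : ‖n‖ = 1)
    (hmenu : ∀ w ∈ fccSlots, ⟪F w, n⟫_ℝ = 0 ∨ ⟪F w, n⟫_ℝ = Real.sqrt (2 / 3) ∨ ⟪F w, n⟫_ℝ = -Real.sqrt (2 / 3))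
    (hvn : 0 < ⟪F v, n⟫_ℝ) (hhalf : ∀ w ∈ fccSlots, 0 ≤ ⟪F w, n⟫_ℝ → p + F w ∈ X)
    (hv : v ∈ fccSlots) (hsteep : Real.sqrt 2 / 2 ≤ ⟪F v, z⟫_ℝ)
    {N : ℕ} (hN : 8 * (H - ⟪p + F v, z⟫_ℝ) < 3 * N) :
    walkEnd X z N (p + F v) [⟨F, v, 0⟩] ∈ X ∧
      (X.filter fun q => dist (walkEnd X z N (p + F v) [⟨F, v, 0⟩]) q = 1).card ≤ 11 ∧
      0 ≤ ⟪walkEnd X z N (p + F v) [⟨F, v, 0⟩] - (p + F v), z⟫_ℝ ∧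
      ‖walkEnd X z N (p + F v) [⟨F, v, 0⟩] - (p + F v)‖ ≤ 8 / 3 * (H - ⟪p + F v, z⟫_ℝ) := by
  have hInv := walkInv_capStart F hp hn hmenu hvn hhalf hv hsteep
  obtain ⟨hyX, hdeg, hrise, hdisp, -, -⟩ := stackWalk_end hX hs₀ hcert hz hH hInv hN
  unfold walkEnd
  dsimp only at hyX hdeg hrise hdisp ⊢
  refine ⟨hyX, hdeg, hrise, le_trans hdisp ?_⟩
  have : ⟪(walkRun X z N (p + F v, [⟨F, v, 0⟩])).1 - (p + F v), z⟫_ℝ ≤ H - ⟪p + F v, z⟫_ℝ := by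
    rw [inner_sub_left]; linarith [hH _ hyX]
  linarith

/-! ### Two-level cap starts: the canonical state on a bilayer of the twin class -/

/-- **The pushed entry is sound and linked.**  `n` a unit menu normal of `F` of height `⟪n, z⟫ ≥ 1/7`, `G` the twin
of `F` across `n`, `v` a slot with `⟪F v, n⟫ = √(2/3)`: the entry `⟨G, bestCapper G n z, n⟩` is `Sound` for `z`
(capper rise `≥ 3/8`, second normal `≥ 1/7`: `best_capper_bounds`) and `Link`ed to `⟨F, v, 0⟩`.  This is the
PUSH computation of `walkStep_spec`, extracted. -/
theorem pushEntry_sound (F G : EuclideanSpace ℝ (Fin 3) ≃ₗᵢ[ℝ] EuclideanSpace ℝ (Fin 3))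
    {n z v : EuclideanSpace ℝ (Fin 3)} (hn : ‖n‖ = 1)
    (hmenu : ∀ w ∈ fccSlots, ⟪F w, n⟫_ℝ = 0 ∨ ⟪F w, n⟫_ℝ = Real.sqrt (2 / 3) ∨ ⟪F w, n⟫_ℝ = -Real.sqrt (2 / 3))
    (hG : ∀ x, G x = F x - (2 * ⟪F x, n⟫_ℝ) • n) (hz : ‖z‖ = 1) (hnz : (1 / 7 : ℝ) ≤ ⟪n, z⟫_ℝ)
    (hv : v ∈ fccSlots) (hvn : ⟪F v, n⟫_ℝ = Real.sqrt (2 / 3)) :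
    (⟨G, bestCapper G n z, n⟩ : WalkEntry).Sound z ∧ (⟨G, bestCapper G n z, n⟩ : WalkEntry).Link ⟨F, v, 0⟩ := by
  classical
  have hrpos : 0 < Real.sqrt (2 / 3) := Real.sqrt_pos.2 (by norm_num)
  have hunit : ∀ (H : EuclideanSpace ℝ (Fin 3) ≃ₗᵢ[ℝ] EuclideanSpace ℝ (Fin 3)) {w : EuclideanSpace ℝ (Fin 3)},
      w ∈ fccSlots → ‖H w‖ = 1 := fun H w hw => by rw [LinearIsometryEquiv.norm_map, norm_eq_one_of_mem_fccSlots hw]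
  have hflip : ∀ x, ⟪G x, n⟫_ℝ = -⟪F x, n⟫_ℝ := inner_twin_eq_neg F G hn hG
  have hmenu' := menu_reflect F G hn hmenu hG
  set S := fccSlots.filter fun q => 0 < ⟪G q, n⟫_ℝ
  have hSne : S.Nonempty := by
    refine ⟨-v, Finset.mem_filter.2 ⟨neg_mem_fccSlots hv, ?_⟩⟩
    rw [map_neg, inner_neg_left, hflip, hvn, neg_neg]; exact hrpos
  obtain ⟨hqS, hqmax⟩ := bestCapper_spec G n z hSne
  set q := bestCapper G n z
  obtain ⟨hqdir, hqpos⟩ := Finset.mem_filter.1 hqS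
  have hqn : ⟪G q, n⟫_ℝ = Real.sqrt (2 / 3) := by
    rcases hmenu' q hqdir with h | h | h
    · rw [h] at hqpos; exact absurd hqpos (lt_irrefl 0)
    · exact h
    · rw [h] at hqpos; linarith
  obtain ⟨q₁, hq₁, q₂, hq₂, q₃, hq₃, hn1, hn2, hn3, h12, h13, h23, -, hexh⟩ := exists_far_frame G hn hmenu'
  have hle_of : ∀ {q'}, q' ∈ fccSlots → ⟪G q', n⟫_ℝ = Real.sqrt (2 / 3) → ⟪G q', z⟫_ℝ ≤ ⟪G q, z⟫_ℝ :=
    fun {q'} hq' hq'n => hqmax q' (Finset.mem_filter.2 ⟨hq', by rw [hq'n]; exact hrpos⟩)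
  have hMeq : ⟪G q, z⟫_ℝ = ⟪G q₁, z⟫_ℝ ∨ ⟪G q, z⟫_ℝ = ⟪G q₂, z⟫_ℝ ∨ ⟪G q, z⟫_ℝ = ⟪G q₃, z⟫_ℝ := by
    rcases hexh q hqdir hqpos with h | h | h
    · left; rw [h]
    · right; left; rw [h]
    · right; right; rw [h]
  have hpair : ∀ {a b : EuclideanSpace ℝ (Fin 3)}, ⟪a, b⟫_ℝ = 1 / 2 → ⟪G a, G b⟫_ℝ = 1 / 2 :=
    fun h => by rw [LinearIsometryEquiv.inner_map_map]; exact h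
  obtain ⟨hM, hM2⟩ := best_capper_bounds (hunit G hq₁) (hunit G hq₂) (hunit G hq₃) hn hz
    (hpair h12) (hpair h13) (hpair h23) hn1 hn2 hn3 hnz (hle_of hq₁ hn1) (hle_of hq₂ hn2) (hle_of hq₃ hn3) hMeq
  exact ⟨⟨hqdir, hn, hmenu', hqn, hnz, hM, hM2⟩, ⟨hG, hvn⟩⟩

/-- **The two-level cap-start state is valid.**  `F v` steep and `n`-positive (`⟪F v, n⟫ = √(2/3)`), `G` the twin of
`F` across the unit menu normal `n`, `q = bestCapper G n z`, and `p ∈ X` with its nine `n`-non-negative `G`-slots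
occupied.  Then `(p + G q, [⟨G, q, n⟩, ⟨F, v, 0⟩])` satisfies `WalkInv` and `StackWF` — the canonical state of a
`(F, v)`-walker standing on a bilayer of the twin class. -/
theorem walkInv_capStart₂ (F G : EuclideanSpace ℝ (Fin 3) ≃ₗᵢ[ℝ] EuclideanSpace ℝ (Fin 3))
    {z p v n : EuclideanSpace ℝ (Fin 3)} (hz : ‖z‖ = 1) (hn : ‖n‖ = 1)
    (hmenu : ∀ w ∈ fccSlots, ⟪F w, n⟫_ℝ = 0 ∨ ⟪F w, n⟫_ℝ = Real.sqrt (2 / 3) ∨ ⟪F w, n⟫_ℝ = -Real.sqrt (2 / 3))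
    (hG : ∀ x, G x = F x - (2 * ⟪F x, n⟫_ℝ) • n)
    (hv : v ∈ fccSlots) (hvn : ⟪F v, n⟫_ℝ = Real.sqrt (2 / 3)) (hsteep : Real.sqrt 2 / 2 ≤ ⟪F v, z⟫_ℝ)
    (hp : p ∈ X) (hhalf : ∀ w ∈ fccSlots, 0 ≤ ⟪G w, n⟫_ℝ → p + G w ∈ X) :
    WalkInv X z (p + G (bestCapper G n z), [⟨G, bestCapper G n z, n⟩, ⟨F, v, 0⟩]) ∧
      StackWF z [⟨G, bestCapper G n z, n⟩, ⟨F, v, 0⟩] := by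
  have hrpos : 0 < Real.sqrt (2 / 3) := Real.sqrt_pos.2 (by norm_num)
  have hunitv : ‖F v‖ = 1 := by rw [LinearIsometryEquiv.norm_map, norm_eq_one_of_mem_fccSlots hv]
  have hnz : (1 / 7 : ℝ) ≤ ⟪n, z⟫_ℝ := inner_ge_seventh_of_steep_across (F v) n z hunitv hn hz hvn hsteep
  obtain ⟨hSo, hLi⟩ := pushEntry_sound F G hn hmenu hG hz hnz hv hvn
  have hqdir : bestCapper G n z ∈ fccSlots := hSo.1
  have hmenu' : ∀ w ∈ fccSlots, ⟪G w, n⟫_ℝ = 0 ∨ ⟪G w, n⟫_ℝ = Real.sqrt (2 / 3) ∨ ⟪G w, n⟫_ℝ = -Real.sqrt (2 / 3) :=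
    hSo.2.2.1
  have hqn : ⟪G (bestCapper G n z), n⟫_ℝ = Real.sqrt (2 / 3) := hSo.2.2.2.1
  have hn0 : n ≠ 0 := fun h => by rw [h, norm_zero] at hn; exact zero_ne_one hn
  refine ⟨⟨hhalf _ hqdir (by rw [hqn]; exact hrpos.le), ⟨hSo, hLi, hv, hsteep⟩, _, _, rfl,
    Or.inr ⟨n, hn, hmenu', by show 0 < ⟪G (bestCapper G n z), n⟫_ℝ; rw [hqn]; exact hrpos, by simp [hp],
      fun w hw h0 => ?_⟩⟩, rfl, hn0, rfl⟩
  simp only [add_sub_cancel_right]; exact hhalf w hw h0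

/-! ### The deterministic zigzag: caps on twin-dozen material -/

/-- **The upper triangle over a capped ball is empty.**  If the cappers `y − F w′ + 2⟪F w′, n⟫ n` of the
`n`-positive slots are occupied then no `n`-positive slot `y + F w` is: it lies at squared distance `1/3` from the
capper of another positive slot (hexagram), impossible in a `1`-separated `X`. -/
theorem upper_slot_empty_of_cappers (hX : ∀ p ∈ X, ∀ q ∈ X, p ≠ q → 1 ≤ dist p q)
    (F : EuclideanSpace ℝ (Fin 3) ≃ₗᵢ[ℝ] EuclideanSpace ℝ (Fin 3)) {y n : EuclideanSpace ℝ (Fin 3)} (hn : ‖n‖ = 1)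
    (hmenu : ∀ w ∈ fccSlots, ⟪F w, n⟫_ℝ = 0 ∨ ⟪F w, n⟫_ℝ = Real.sqrt (2 / 3) ∨ ⟪F w, n⟫_ℝ = -Real.sqrt (2 / 3))
    (hcap : ∀ w ∈ fccSlots, 0 < ⟪F w, n⟫_ℝ → y - F w + (2 * ⟪F w, n⟫_ℝ) • n ∈ X) :
    ∀ w ∈ fccSlots, 0 < ⟪F w, n⟫_ℝ → y + F w ∉ X := by
  intro w hw hwpos hmem
  have hrpos : 0 < Real.sqrt (2 / 3) := Real.sqrt_pos.2 (by norm_num)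
  have hpos_eq : ∀ {u}, u ∈ fccSlots → 0 < ⟪F u, n⟫_ℝ → ⟪F u, n⟫_ℝ = Real.sqrt (2 / 3) := by
    intro u hu hupos
    rcases hmenu u hu with h | h | h
    · rw [h] at hupos; exact absurd hupos (lt_irrefl 0)
    · exact h
    · rw [h] at hupos; linarith
  have hwn : ⟪F w, n⟫_ℝ = Real.sqrt (2 / 3) := hpos_eq hw hwpos
  -- another positive slot `w′ ≠ w`, at `60°` from `w`
  obtain ⟨w', hw', hw'n, hw'w⟩ := exists_pos_slot_ne F hn hmenu w
  have hww' : ⟪w, w'⟫_ℝ = 1 / 2 :=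
    inner_eq_half_of_pos_pos F hn hmenu hw hw' (Ne.symm hw'w) hwpos (by rw [hw'n]; exact hrpos)
  -- its capper is occupied
  have hb : y + F (-w') - (2 * Real.sqrt (2 / 3)) • (-n) ∈ X := by
    have := hcap w' hw' (by rw [hw'n]; exact hrpos)
    rw [hw'n] at this
    have e : y + F (-w') - (2 * Real.sqrt (2 / 3)) • (-n) = y - F w' + (2 * Real.sqrt (2 / 3)) • n := by
      rw [map_neg, smul_neg]; abel
    rw [e]; exact this
  -- hexagram for the normal `−n`: `w` is `(−n)`-negative, `−w′` is `(−n)`-positive, `⟪w, −w′⟫ = −½`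
  have hmn : ‖-n‖ = 1 := by rw [norm_neg, hn]
  refine false_of_dist_sq_eq_third hX hmem hb (dist_sq_hexagram F hmn hw (neg_mem_fccSlots hw') ?_ ?_ ?_ y)
  · rw [inner_neg_right, hwn]
  · rw [map_neg, inner_neg_left, inner_neg_right, neg_neg, hw'n]
  · rw [inner_neg_right, hww']

/-- **Twin dozen ⇒ oriented cap.**  `n` a unit menu normal of `F`, `⟪F v, n⟫ = √(2/3)`, the nine `n`-non-positive
`F`-slots of `y` occupied and the three cappers occupied: `y` is an exact cap of `F` oriented along `v` with normal
`n` (the emptiness of the upper triangle is `upper_slot_empty_of_cappers`). -/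
theorem isOrientedCap_of_twinDozen (hX : ∀ p ∈ X, ∀ q ∈ X, p ≠ q → 1 ≤ dist p q)
    (F : EuclideanSpace ℝ (Fin 3) ≃ₗᵢ[ℝ] EuclideanSpace ℝ (Fin 3)) {y v n : EuclideanSpace ℝ (Fin 3)} (hn : ‖n‖ = 1)
    (hmenu : ∀ w ∈ fccSlots, ⟪F w, n⟫_ℝ = 0 ∨ ⟪F w, n⟫_ℝ = Real.sqrt (2 / 3) ∨ ⟪F w, n⟫_ℝ = -Real.sqrt (2 / 3))
    (hvn : ⟪F v, n⟫_ℝ = Real.sqrt (2 / 3))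
    (hle : ∀ w ∈ fccSlots, ⟪F w, n⟫_ℝ ≤ 0 → y + F w ∈ X)
    (hcap : ∀ w ∈ fccSlots, 0 < ⟪F w, n⟫_ℝ → y - F w + (2 * ⟪F w, n⟫_ℝ) • n ∈ X) :
    IsOrientedCap X F y v n :=
  ⟨hn, hmenu, hvn, hle, fun w hw h0 => ⟨upper_slot_empty_of_cappers hX F hn hmenu hcap w hw h0, hcap w hw h0⟩⟩

/-- An oriented cap is not full in its frame (the arrival slot `y + F v` is empty). -/
theorem not_full_of_isOrientedCap (F : EuclideanSpace ℝ (Fin 3) ≃ₗᵢ[ℝ] EuclideanSpace ℝ (Fin 3))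
    {y v n : EuclideanSpace ℝ (Fin 3)} (hv : v ∈ fccSlots) (h : IsOrientedCap X F y v n) :
    ¬ ∀ w ∈ fccSlots, y + F w ∈ X := by
  intro hfull
  obtain ⟨-, -, hvn, -, hgt⟩ := h
  have hrpos : 0 < Real.sqrt (2 / 3) := Real.sqrt_pos.2 (by norm_num)
  exact (hgt v hv (by rw [hvn]; exact hrpos)).1 (hfull v hv)

/-- **The cap normal is unique.**  Two oriented-cap structures at `y` for the same frame `F` and arrival slot `v`
(in a `1`-separated `X`) have the same normal: otherwise the second normal is the mirror `2√(2/3) F v − n` and a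
positive slot of the first (empty) is in-plane for the second (occupied). -/
theorem orientedCap_normal_unique
    (F : EuclideanSpace ℝ (Fin 3) ≃ₗᵢ[ℝ] EuclideanSpace ℝ (Fin 3)) {y v n n' : EuclideanSpace ℝ (Fin 3)}
    (hv : v ∈ fccSlots) (h : IsOrientedCap X F y v n) (h' : IsOrientedCap X F y v n') : n' = n := by
  obtain ⟨hn, hmenu, hvn, -, hgt⟩ := h
  obtain ⟨hn', hmenu', hvn', hle', -⟩ := h'
  by_contra hne
  have hrpos : 0 < Real.sqrt (2 / 3) := Real.sqrt_pos.2 (by norm_num)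
  have hFv : ‖F v‖ = 1 := by rw [LinearIsometryEquiv.norm_map, norm_eq_one_of_mem_fccSlots hv]
  rcases menu_normal_eq_or_eq_twin F hn hn' hFv hmenu hmenu' hvn hvn' with heq | htw
  · exact hne heq
  -- a positive slot `p₀ ≠ v` of `n` is in-plane for `n′ = 2√(2/3) F v − n`
  obtain ⟨p₀, hp₀, hp₀n, hp₀v⟩ := exists_pos_slot_ne F hn hmenu v
  have hvp₀ : ⟪v, p₀⟫_ℝ = 1 / 2 :=
    inner_eq_half_of_pos_pos F hn hmenu hv hp₀ (Ne.symm hp₀v) (by rw [hvn]; exact hrpos) (by rw [hp₀n]; exact hrpos)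
  have h0 : ⟪F p₀, n'⟫_ℝ = 0 := by
    rw [htw, inner_sub_right, real_inner_smul_right, LinearIsometryEquiv.inner_map_map, real_inner_comm v p₀, hvp₀,
      hp₀n]
    ring
  exact (hgt p₀ hp₀ (by rw [hp₀n]; exact hrpos)).1 (hle' p₀ hp₀ h0.le)

/-- **PUSH at a one-level walker on a cap.**  At `(y, [⟨F, v, m⟩])` with `y` an exact cap of `F` oriented along `v`
with normal `n`, the step enters the twin frame: `some (y + G q, [⟨G, q, n⟩, ⟨F, v, m⟩])` with `G = twinFrame F n`,
`q = bestCapper G n z`. -/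
theorem walkStep_push_of_orientedCap_nil
    {z y : EuclideanSpace ℝ (Fin 3)} {F : EuclideanSpace ℝ (Fin 3) ≃ₗᵢ[ℝ] EuclideanSpace ℝ (Fin 3)}
    {v m n : EuclideanSpace ℝ (Fin 3)} (hv : v ∈ fccSlots) (h : IsOrientedCap X F y v n) :
    walkStep X z (y, [⟨F, v, m⟩]) =
      some (y + twinFrame F n (bestCapper (twinFrame F n) n z),
        [⟨twinFrame F n, bestCapper (twinFrame F n) n z, n⟩, ⟨F, v, m⟩]) := by
  classical
  have hcap : ∃ n₁, IsOrientedCap X (⟨F, v, m⟩ : WalkEntry).frame y (⟨F, v, m⟩ : WalkEntry).dir n₁ := ⟨n, h⟩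
  have hnf : ¬ ∀ w ∈ fccSlots, y + (⟨F, v, m⟩ : WalkEntry).frame w ∈ X := not_full_of_isOrientedCap F hv h
  rw [walkStep_of_cap X z y ⟨F, v, m⟩ [] hnf hcap, capMove_nil]
  have hn₁ : Classical.choose hcap = n := orientedCap_normal_unique F hv h (Classical.choose_spec hcap)
  rw [hn₁]
  rfl

/-- **PUSH at a deeper walker on a cap with a NEW normal.**  At `(y, ⟨F, v, m⟩ :: e′ :: rest)` with `y` an exact cap
of `F` along `v` with normal `n ≠ m`, the step is the push into `twinFrame F n`. -/
theorem walkStep_push_of_orientedCap_ne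
    {z y : EuclideanSpace ℝ (Fin 3)} {F : EuclideanSpace ℝ (Fin 3) ≃ₗᵢ[ℝ] EuclideanSpace ℝ (Fin 3)}
    {v m n : EuclideanSpace ℝ (Fin 3)} (e' : WalkEntry) (rest : List WalkEntry) (hv : v ∈ fccSlots)
    (h : IsOrientedCap X F y v n) (hne : n ≠ m) :
    walkStep X z (y, ⟨F, v, m⟩ :: e' :: rest) =
      some (y + twinFrame F n (bestCapper (twinFrame F n) n z),
        ⟨twinFrame F n, bestCapper (twinFrame F n) n z, n⟩ :: ⟨F, v, m⟩ :: e' :: rest) := by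
  classical
  have hcap : ∃ n₁, IsOrientedCap X (⟨F, v, m⟩ : WalkEntry).frame y (⟨F, v, m⟩ : WalkEntry).dir n₁ := ⟨n, h⟩
  have hnf : ¬ ∀ w ∈ fccSlots, y + (⟨F, v, m⟩ : WalkEntry).frame w ∈ X := not_full_of_isOrientedCap F hv h
  rw [walkStep_of_cap X z y ⟨F, v, m⟩ (e' :: rest) hnf hcap]
  have hn₁ : Classical.choose hcap = n := orientedCap_normal_unique F hv h (Classical.choose_spec hcap)
  rw [hn₁, capMove_cons_of_ne z y ⟨F, v, m⟩ e' rest (show n ≠ (⟨F, v, m⟩ : WalkEntry).nrm from hne)]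
  rfl

/-- **POP at a walker on a cap through its own entry normal.**  At `(y, ⟨G, q, n⟩ :: e′ :: rest)` with `y` an exact
cap of `G` along `q` with normal `n` (the entry normal of the top level), the lamella closes: the step is
`some (y + e′.frame e′.dir, e′ :: rest)`. -/
theorem walkStep_pop_of_orientedCap
    {z y : EuclideanSpace ℝ (Fin 3)} {G : EuclideanSpace ℝ (Fin 3) ≃ₗᵢ[ℝ] EuclideanSpace ℝ (Fin 3)}
    {q n : EuclideanSpace ℝ (Fin 3)} (e' : WalkEntry) (rest : List WalkEntry) (hq : q ∈ fccSlots)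
    (h : IsOrientedCap X G y q n) :
    walkStep X z (y, ⟨G, q, n⟩ :: e' :: rest) = some (y + e'.frame e'.dir, e' :: rest) := by
  classical
  have hcap : ∃ n₁, IsOrientedCap X (⟨G, q, n⟩ : WalkEntry).frame y (⟨G, q, n⟩ : WalkEntry).dir n₁ := ⟨n, h⟩
  have hnf : ¬ ∀ w ∈ fccSlots, y + (⟨G, q, n⟩ : WalkEntry).frame w ∈ X := not_full_of_isOrientedCap G hq h
  rw [walkStep_of_cap X z y ⟨G, q, n⟩ (e' :: rest) hnf hcap]
  have hn₁ : Classical.choose hcap = n := orientedCap_normal_unique G hq h (Classical.choose_spec hcap)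
  rw [capMove_cons_of_eq z y ⟨G, q, n⟩ e' rest (show Classical.choose hcap = (⟨G, q, n⟩ : WalkEntry).nrm from hn₁)]

/-! ### Orbit-free start families are end-injective -/

/-- Heights never decrease along a run (from the displacement bound of `walkRun_spec`). -/
theorem walkRun_height_ge (hX : ∀ p ∈ X, ∀ q ∈ X, p ≠ q → 1 ≤ dist p q)
    {s₀ : EuclideanSpace ℝ (Fin 3)} (hs₀ : s₀ ∈ fccSlots)
    (hcert : ExactOnly 0 (fccSlots.filter fun w => 0 < ⟪w, s₀⟫_ℝ))
    {z : EuclideanSpace ℝ (Fin 3)} (hz : ‖z‖ = 1) (k : ℕ) (s : EuclideanSpace ℝ (Fin 3) × List WalkEntry)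
    (hI : WalkInv X z s) : ⟪s.1, z⟫_ℝ ≤ ⟪(walkRun X z k s).1, z⟫_ℝ := by
  obtain ⟨-, hdisp, -⟩ := walkRun_spec hX hs₀ hcert hz k s hI
  have h0 : 0 ≤ ⟪(walkRun X z k s).1 - s.1, z⟫_ℝ := by
    nlinarith [norm_nonneg ((walkRun X z k s).1 - s.1)]
  rw [inner_sub_left] at h0
  linarith

/-- **Exit criterion for orbit-freeness.**  If the state `s` sits at height `≤ H₀`, the valid state `s′ ≠ s` has its
FIRST step (if any) landing above `H₀`, then no iterate of `s′` equals `s`. -/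
theorem walkRun_ne_of_exit (hX : ∀ p ∈ X, ∀ q ∈ X, p ≠ q → 1 ≤ dist p q)
    {s₀ : EuclideanSpace ℝ (Fin 3)} (hs₀ : s₀ ∈ fccSlots)
    (hcert : ExactOnly 0 (fccSlots.filter fun w => 0 < ⟪w, s₀⟫_ℝ))
    {z : EuclideanSpace ℝ (Fin 3)} (hz : ‖z‖ = 1) {s s' : EuclideanSpace ℝ (Fin 3) × List WalkEntry} {H₀ : ℝ}
    (hI' : WalkInv X z s') (hlow : ⟪s.1, z⟫_ℝ ≤ H₀)
    (hexit : ∀ s'', walkStep X z s' = some s'' → H₀ < ⟪s''.1, z⟫_ℝ) (hne : s' ≠ s) :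
    ∀ k, walkRun X z k s' ≠ s
  | 0 => hne
  | k + 1 => by
    cases h : walkStep X z s' with
    | none => rw [walkRun_succ_of_none X z k h]; exact hne
    | some s'' =>
      rw [walkRun_succ_of_some X z k h]
      intro heq
      obtain ⟨hI'', -, -⟩ := walkStep_walkInv hX hs₀ hcert hz hI' h
      have h1 := walkRun_height_ge hX hs₀ hcert hz k s'' hI''
      have h2 := hexit s'' h
      rw [heq] at h1
      linarith

/-- **Orbit-free families are end-injective.**  A finite family of valid states (`WalkInv ∧ StackWF`), no member on
the forward orbit of another (in particular pairwise distinct), is mapped injectively by `walkRun X z N`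
(backward determinism `walkRun_eq_walkRun_orbit`). -/
theorem walkRun_injOn_of_orbitFree (hX : ∀ p ∈ X, ∀ q ∈ X, p ≠ q → 1 ≤ dist p q)
    {s₀ : EuclideanSpace ℝ (Fin 3)} (hs₀ : s₀ ∈ fccSlots)
    (hcert : ExactOnly 0 (fccSlots.filter fun w => 0 < ⟪w, s₀⟫_ℝ))
    {z : EuclideanSpace ℝ (Fin 3)} (hz : ‖z‖ = 1) {ι : Type*} (T : Finset ι)
    (st : ι → EuclideanSpace ℝ (Fin 3) × List WalkEntry)
    (hvalid : ∀ i ∈ T, WalkInv X z (st i) ∧ StackWF z (st i).2)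
    (hfree : ∀ i ∈ T, ∀ j ∈ T, i ≠ j → ∀ k, walkRun X z k (st i) ≠ st j) (N : ℕ) :
    ∀ i ∈ T, ∀ j ∈ T, walkRun X z N (st i) = walkRun X z N (st j) → i = j := by
  intro i hi j hj h
  by_contra hij
  rcases walkRun_eq_walkRun_orbit hX hs₀ hcert hz N (hvalid i hi).1 (hvalid i hi).2 (hvalid j hj).1 (hvalid j hj).2 h
    with ⟨k, hk⟩ | ⟨k, hk⟩
  · exact hfree i hi j hj hij k hk
  · exact hfree j hj i hi (Ne.symm hij) k hk

/-- **End-injectivity by the exit criterion.**  A finite family of valid, pairwise distinct start states at heights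
`≤ H₀`, each of whose first step (if any) lands above `H₀`, is mapped injectively by `walkRun X z N`.  (For the tops
of a clamped sample along steep lines this is the situation of `walkRun_start_injective`; here nothing below the
start balls is read.) -/
theorem walkRun_injOn_of_exit (hX : ∀ p ∈ X, ∀ q ∈ X, p ≠ q → 1 ≤ dist p q)
    {s₀ : EuclideanSpace ℝ (Fin 3)} (hs₀ : s₀ ∈ fccSlots)
    (hcert : ExactOnly 0 (fccSlots.filter fun w => 0 < ⟪w, s₀⟫_ℝ))
    {z : EuclideanSpace ℝ (Fin 3)} (hz : ‖z‖ = 1) {ι : Type*} (T : Finset ι)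
    (st : ι → EuclideanSpace ℝ (Fin 3) × List WalkEntry) {H₀ : ℝ}
    (hvalid : ∀ i ∈ T, WalkInv X z (st i) ∧ StackWF z (st i).2)
    (hinj : ∀ i ∈ T, ∀ j ∈ T, st i = st j → i = j)
    (hlow : ∀ i ∈ T, ⟪(st i).1, z⟫_ℝ ≤ H₀)
    (hexit : ∀ i ∈ T, ∀ s'', walkStep X z (st i) = some s'' → H₀ < ⟪s''.1, z⟫_ℝ) (N : ℕ) :
    ∀ i ∈ T, ∀ j ∈ T, walkRun X z N (st i) = walkRun X z N (st j) → i = j :=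
  walkRun_injOn_of_orbitFree hX hs₀ hcert hz T st hvalid
    (fun i hi j hj hij => walkRun_ne_of_exit hX hs₀ hcert hz (hvalid i hi).1 (hlow j hj) (hexit i hi)
      (fun h => hij (hinj i hi j hj h))) N

end Summit.Ventures.Crystal3D.Theorems

end
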